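import Mathlib
import Summits.PneNP.PneNP.Theses.ConvexRankGates

/-!
Sketch for crux-ideate stmt-PneNP-10680 (ConvexGateBlind), ideator 1, round 1.
First lemmas of the two idea cards, stated over existing declarations
(Literature.Computability.Complexity.{GateFn, Circuit, IsOver, Computes, size} and the route decl
Summit.PneNP.PneNP.Theses.ConvexRankGates.ConvexGateBlind). Nothing is proved here.
-/

namespace Summit.PneNP.PneNP.Cruxes.ConvexGateBlind.Sketch

open scoped BigOperators Classical
open Filter Literature.Computability.Complexity

/-- LP-feasibility gates (the diagonal / Oliveira–Pudlák weak-MLP sub-class of the crux's CONV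
gates): `v ↦ [∃ y ≥ 0, A y ≤ b + B v]` with `B ≥ 0`, `#rows + #columns ≤ s`. -/
def ConvLP (s : ℕ) : Set GateFn :=
  {g | ∃ (p q : ℕ), p + q ≤ s ∧ ∃ (A : Matrix (Fin p) (Fin q) ℝ) (b : Fin p → ℝ)
      (B : Fin p → Fin g.1 → ℝ), (∀ i j, 0 ≤ B i j) ∧ ∀ v : Fin g.1 → Bool,
      g.2 v = true ↔ ∃ y : Fin q → ℝ, (∀ j, 0 ≤ y j) ∧
        ∀ i, (A.mulVec y) i ≤ b i + ∑ j, B i j * (if v j then (1 : ℝ) else 0)}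

/-- The clique function of the crux, verbatim (inline form, rfl-equal to `cliqueFn m k`). -/
noncomputable def cliqueInline (m k : ℕ) (x : (⊤ : SimpleGraph (Fin m)).edgeSet → Bool) : Bool :=
  decide (¬ (SimpleGraph.fromEdgeSet {e : Sym2 (Fin m) | ∃ h : e ∈ (⊤ : SimpleGraph (Fin m)).edgeSet,
    x ⟨e, h⟩ = true}).CliqueFree k)

/-- The LP half of the crux: no polynomial-size `{∧₂,∨₂} + LP-feasibility` circuit computes
CLIQUE(m, ⌈m^δ⌉). (Implied by `ConvexGateBlind`: ConvLP s ⊆ Conv s via diagonal `Y`.) -/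
def ConvexGateBlindLP : Prop :=
  ∃ δ : ℝ, 0 < δ ∧ δ < 1 / 2 ∧ ∀ c : ℕ, ∀ᶠ m : ℕ in atTop,
    ∀ C : Circuit ((⊤ : SimpleGraph (Fin m)).edgeSet),
      C.IsOver ({GateFn.and 2, GateFn.or 2} ∪ ConvLP (m ^ c)) → C.size ≤ m ^ c →
        ¬ C.Computes (cliqueInline m ⌈(m : ℝ) ^ δ⌉₊)

/-- One-sided Hamming distance `|E(K_S) \ u|`: the number of edges of the clique on `S` that are
missing from the graph `u` (Hrubeš's `h_+`, the entry of `M_+(CLIQUE)` at (clique S, graph u)). -/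
noncomputable def cliqueDist {m : ℕ} (S : Finset (Fin m)) (u : Sym2 (Fin m) → Bool) : ℕ :=
  ((S ×ˢ S).filter (fun p : Fin m × Fin m => p.1 < p.2 ∧ u s(p.1, p.2) = false)).card

/-- CARD A, target statement (Hrubeš strict rank, conic form): for every `c`, eventually in `m`,
there are NO `r ≤ m^c` strictly positive functions `a_i` on `k`-cliques (`k = ⌈m^δ⌉`) such that
for every `k`-clique-free graph `u` the distance profile `S ↦ |E(K_S) \ u|` is a nonnegative
combination of the `a_i`.  Equivalently `rk_{++}(M_+(CLIQUE(m,k)))` is superpolynomial. -/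
def StrictRankCliqueSuperpoly : Prop :=
  ∃ δ : ℝ, 0 < δ ∧ δ < 1 / 2 ∧ ∀ c : ℕ, ∀ᶠ m : ℕ in atTop, ∀ r : ℕ, r ≤ m ^ c →
    ¬ ∃ a : Fin r → Finset (Fin m) → ℝ,
        (∀ i S, S.card = ⌈(m : ℝ) ^ δ⌉₊ → 0 < a i S) ∧
        ∀ u : Sym2 (Fin m) → Bool,
          (SimpleGraph.fromEdgeSet {e : Sym2 (Fin m) | u e = true}).CliqueFree ⌈(m : ℝ) ^ δ⌉₊ →
          ∃ μ : Fin r → ℝ, (∀ i, 0 ≤ μ i) ∧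
            ∀ S : Finset (Fin m), S.card = ⌈(m : ℝ) ^ δ⌉₊ →
              (cliqueDist S u : ℝ) = ∑ i, μ i * a i S

/-- CARD A, first lemma (ε-elimination; Farkas + Hrubeš 2019 Lemma 16 / Prop. 17 / Thm. 20 adapted
to the `B ≥ 0` feasibility format and to AND/OR+LP circuits collapsing to one LP gate):
a polynomial AND/OR+LP circuit for CLIQUE would give a strictly positive conic cover of
polynomial size (size `s` circuit ⇒ `r ≤ O(s·n)`), so the strict-rank bound implies the LP half. -/
def FirstLemmaA : Prop := StrictRankCliqueSuperpoly → ConvexGateBlindLP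

/-- XOR-UNSAT on `n` variables as a monotone function of the selected affine equations over 𝔽₂
(same function as the route's support item `XorUnsatIsOnePermGate`). -/
def xorUnsat (n : ℕ) (v : (Fin n → ZMod 2) × ZMod 2 → Bool) : Bool :=
  decide (¬ ∃ y : Fin n → ZMod 2, ∀ e : (Fin n → ZMod 2) × ZMod 2, v e = true → e.1 ⬝ᵥ y = e.2)

/-- The crux's CONV gate class, verbatim. -/
def Conv (s : ℕ) : Set GateFn :=
  {g | ∃ (p q : ℕ), p + q ≤ s ∧ ∃ (A : Fin p → Matrix (Fin q) (Fin q) ℝ) (b : Fin p → ℝ)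
      (B : Fin p → Fin g.1 → ℝ), (∀ i j, 0 ≤ B i j) ∧ ∀ v : Fin g.1 → Bool,
      g.2 v = true ↔ ∃ Y : Matrix (Fin q) (Fin q) ℝ, Y.PosSemidef ∧
        ∀ i, (A i * Y).trace ≤ b i + ∑ j, B i j * (if v j then (1 : ℝ) else 0)}

/-- CARD B, target statement (door separation): convex gates are blind to the PERM door —
no polynomial `{∧₂,∨₂} + CONV` circuit computes XOR-UNSAT. -/
def XorUnsatConvBlind : Prop :=
  ∀ c : ℕ, ∀ᶠ n : ℕ in atTop, ∀ C : Circuit ((Fin n → ZMod 2) × ZMod 2),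
    C.IsOver ({GateFn.and 2, GateFn.or 2} ∪ Conv (n ^ c)) → C.size ≤ n ^ c →
      ¬ C.Computes (xorUnsat n)

/-- CARD B, first lemma (mNP-universality of CLIQUE for CONV-circuit size under monotone
AND-substitutions + vertex padding to reach `k = ⌈m^δ⌉`, any fixed `δ ∈ (0,1/2)`):
blindness on XOR-UNSAT transfers to the crux as filed. -/
def FirstLemmaB : Prop :=
  XorUnsatConvBlind → Summit.PneNP.PneNP.Theses.ConvexRankGates.ConvexGateBlind

/-- 3XOR-UNSAT on `n` variables with the POLYNOMIAL (3-sparse) pool: input = which of the `2n³` equations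
`y i + y j + y l = b` are selected; output = the selected system is unsatisfiable. (Card B's corrected target: with the
full affine pool the size transfer to CLIQUE is void.) -/
def xor3Unsat (n : ℕ) (v : Fin n × Fin n × Fin n × ZMod 2 → Bool) : Bool :=
  decide (¬ ∃ y : Fin n → ZMod 2, ∀ e : Fin n × Fin n × Fin n × ZMod 2, v e = true →
    y e.1 + y e.2.1 + y e.2.2.1 = e.2.2.2)

/-- CARD B, corrected target statement over the 3-sparse pool. -/
def Xor3UnsatConvBlind : Prop :=
  ∀ c : ℕ, ∀ᶠ n : ℕ in atTop, ∀ C : Circuit (Fin n × Fin n × Fin n × ZMod 2),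
    C.IsOver ({GateFn.and 2, GateFn.or 2} ∪ Conv (n ^ c)) → C.size ≤ n ^ c →
      ¬ C.Computes (xor3Unsat n)

/-- CARD B, first lemma in the form to be filed as a stub: mNP-universality of CLIQUE(m,⌈m^δ⌉) under monotone
AND-substitution + padding transfers CONV-blindness from 3XOR-UNSAT (poly pool) to the crux. -/
def FirstLemmaB3 : Prop :=
  Xor3UnsatConvBlind → Summit.PneNP.PneNP.Theses.ConvexRankGates.ConvexGateBlind

end Summit.PneNP.PneNP.Cruxes.ConvexGateBlind.Sketch
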